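import Literature.AlgebraicGeometry.Resolution.NoetherianComponents
import Mathlib.AlgebraicGeometry.Noetherian
import Mathlib.Topology.Connected.LocallyConnected
import HarnessLib

/-!
# Locally Noetherian schemes are locally connected: connected components are open (and closed)

Layer `Literature/AlgebraicGeometry/Morphisms`, namespace `Literature.AlgebraicGeometry.Morphisms`.  THEOREMS ONLY (no
definition, no named fact, no instance).

In a Noetherian topological space connected components are clopen (★ `Resolution.NoetherianComponents`: the complement of a
component is the finite union of the irreducible components missing it; `isOpen_connectedComponent_of_noetherianSpace`).  A locally Noetherian scheme is covered by affine opens with Noetherian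
coordinate rings, whose underlying spaces are Noetherian; applying the above inside such neighbourhoods gives a basis of open
connected neighbourhoods (`locallyConnectedSpace_of_isLocallyNoetherian`), hence clopen connected components
(`isClopen_connectedComponent_of_isLocallyNoetherian`).  [GortzWedhorn2020] Section (3.8), Exercises 3.15–3.16 (p. 92); [StacksProject, Tag 04MF
(a locally Noetherian topological space is locally connected), Tag 04ME, Tag 0052].  Cell `hodgecm-mathlib` (D-0151): the «componentwise»
step of the HECKE-LINK (K) assembly (B-plan1 (g14) 21:39:01Z (P1): «(K) is proved COMPONENTWISE — components of a locally
Noetherian `S` are clopen»).  Count-neutral; nothing here is about HC.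

## References
* [GortzWedhorn2020] U. Görtz, T. Wedhorn, *Algebraic Geometry I* (2nd ed. 2020), Section (3.8), Exercises 3.15–3.16 (p. 92).
* [StacksProject] The Stacks Project, Tag 04MF, Tag 04ME, Tag 0052.
-/

set_option autoImplicit false

noncomputable section

universe u

open CategoryTheory AlgebraicGeometry TopologicalSpace Topology

namespace Literature.AlgebraicGeometry.Morphisms

/-! ## §1 Noetherian topological spaces -/

/-- **In a Noetherian topological space every connected component is open** (★
`Resolution.isClopen_connectedComponent_of_noetherianSpace`: its complement is the finite union of the irreducible components
disjoint from it). [cite: StacksProject, Tag 0052] [cite: GortzWedhorn2020, Section (3.8)] -/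
theorem isOpen_connectedComponent_of_noetherianSpace {X : Type u} [TopologicalSpace X] [NoetherianSpace X] (x : X) :
    IsOpen (connectedComponent x) :=
  (Literature.AlgebraicGeometry.Resolution.isClopen_connectedComponent_of_noetherianSpace x).isOpen

/-- **A topological space covered by Noetherian open subspaces is locally connected**: inside a Noetherian open neighbourhood
`V` of `x` contained in a given neighbourhood, the connected component of `x` in `V` is open in `V`, hence open, connected and
containing `x`. [cite: StacksProject, Tag 04MF] -/
theorem locallyConnectedSpace_of_forall_exists_noetherianSpace {X : Type u} [TopologicalSpace X]
    (h : ∀ (x : X) (U : Set X), U ∈ 𝓝 x → ∃ V : Set X, IsOpen V ∧ x ∈ V ∧ V ⊆ U ∧ NoetherianSpace V) :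
    LocallyConnectedSpace X := by
  rw [locallyConnectedSpace_iff_subsets_isOpen_isConnected]
  intro x U hU
  obtain ⟨V, hVo, hxV, hVU, hVn⟩ := h x U hU
  -- the connected component of `x` inside the Noetherian open `V`
  let x' : V := ⟨x, hxV⟩
  have hop : IsOpen (connectedComponent x') := isOpen_connectedComponent_of_noetherianSpace x'
  refine ⟨(↑) '' connectedComponent x', ?_, hVo.isOpenMap_subtype_val _ hop, ⟨x', mem_connectedComponent, rfl⟩, ?_⟩
  · rintro _ ⟨y, -, rfl⟩
    exact hVU y.2
  · exact isConnected_connectedComponent.image _ continuous_subtype_val.continuousOn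

/-! ## §2 Locally Noetherian schemes -/

/-- **A locally Noetherian scheme is locally connected** (every point has a basis of open connected neighbourhoods): the
affine opens with Noetherian coordinate ring form a basis of the topology and have Noetherian underlying spaces (Mathlib
`noetherianSpace_of_isAffineOpen`). [cite: StacksProject, Tag 04MF] [cite: GortzWedhorn2020, Exercises 3.15–3.16 (p. 92)] -/
theorem locallyConnectedSpace_of_isLocallyNoetherian (X : Scheme.{u}) [IsLocallyNoetherian X] : LocallyConnectedSpace X := by
  refine locallyConnectedSpace_of_forall_exists_noetherianSpace fun x U hU => ?_
  obtain ⟨W, hWU, hWo, hxW⟩ := mem_nhds_iff.mp hU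
  -- an affine open neighbourhood of `x` inside `W`; its coordinate ring is Noetherian
  obtain ⟨V, hVaff, hxV, hVW⟩ := (Opens.isBasis_iff_nbhd.mp X.isBasis_affineOpens) (show x ∈ (⟨W, hWo⟩ : X.Opens) from hxW)
  haveI : IsNoetherianRing Γ(X, V) := IsLocallyNoetherian.component_noetherian ⟨V, hVaff⟩
  have hVn : NoetherianSpace V := noetherianSpace_of_isAffineOpen V hVaff
  exact ⟨(V : Set X), V.isOpen, hxV, fun y hy => hWU (hVW hy), hVn⟩

/-- **Connected components of a locally Noetherian scheme are clopen.** [cite: StacksProject, Tag 04MF] [cite: GortzWedhorn2020, Exercises 3.15–3.16 (p. 92)] -/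
theorem isClopen_connectedComponent_of_isLocallyNoetherian (X : Scheme.{u}) [IsLocallyNoetherian X] (x : X) :
    IsClopen (connectedComponent x) :=
  haveI := locallyConnectedSpace_of_isLocallyNoetherian X
  isClopen_connectedComponent

/-- The connected component of a point of a locally Noetherian scheme, as an OPEN subscheme. [cite: StacksProject, Tag 04MF] -/
theorem isOpen_connectedComponent_of_isLocallyNoetherian (X : Scheme.{u}) [IsLocallyNoetherian X] (x : X) :
    IsOpen (connectedComponent x) :=
  (isClopen_connectedComponent_of_isLocallyNoetherian X x).isOpen

end Literature.AlgebraicGeometry.Morphisms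

end
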